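import Mathlib
import HarnessLib
import Literature.MathematicalPhysics.QuantumLattice.FermiRG.BGM2003Sectors
import Summits.HubbardSuperconductivity.HubbardSuperconductivity.Theorems.KLProgrammeAbsUmklappTargetCount
import Summits.HubbardSuperconductivity.HubbardSuperconductivity.Theorems.KLProgrammeH10TwoPointLimitPerturbedFermiChartUniform
import Summits.HubbardSuperconductivity.HubbardSuperconductivity.Theorems.KLProgrammeH10TwoPointLimitPerturbedSectorBoxUniform
import Summits.HubbardSuperconductivity.HubbardSuperconductivity.Theorems.KLProgrammeH10TwoPointLimitPerturbedNormalAngleLipschitz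

/-!
# Route `KLProgramme` — K3 engine (stmt-HubbardSuperconductivity-20437), stub (b) (ℓ)/(I2)–(I3), located item «ABS-UMK-COUNT»:
# the anchored absolute `(L−3)` count of target strings ON THE PERTURBED CURVE, ONE set of constants for the whole family

Cell gate-hubbard-kl, seat p4 g15 (frame-uniform discharger, twin of `sectorCounting_perturbed_uniform` for the umklapp/target count).  Composition of
`AbsUmklappCount.card_targetStrings_le` (BGM 2003 `DispersionHyp` level, explicit constants) with the lineage's δ-UNIFORM data for the chart
`u₂ θ e := perturbedFermiRadius δ (μ + e) θ`: `dispersionHyp_perturbed` (§1.2), `normalAngle_perturbed_lipschitz/add_pi` (Lemma 7.1),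
`sectorBox_perturbed_uniform` (Lemma 7.3), `lemma75_parallelogram_of_bounds` fed by `chart_radius_ge/bounds`, `chart_curvature_ge` (Lemma 7.5), and
`fermiChart_perturbed_uniform` (the polar chart package):

* **`targetStrings_perturbed_uniform`** — for `B : BandBounds a b`, sizes `κ₁, κ₂` with `2κ₁ ≤ Dt_min` and the convexity margin, and a shell `e₀ > 0`:
  thirteen constants `(c₂, c₃, K₁, K₂, c₀, c₂′, η₀, s₁, Φ, c_f, A_f, B_f, M₁)` chosen BEFORE `δ, μ` such that for EVERY even `δ ∈ C^∞` with
  `|δ| ≤ κ₀`, `‖Dδ‖ ≤ κ₁`, `‖D²δ‖ ≤ κ₂` and every admissible `μ`, the bound of `card_targetStrings_le` holds for the chart's target strings with THESE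
  constants (in its fine-scale regime, stated verbatim).

Everything is PROVED by composition; no definitions, no named facts. [cite: BenfattoGiulianiMastropietro2003, §3.1 Lemma 3.1 and §7.1–§7.4]
[cite: BenfattoGiulianiMastropietro2006, §2.4 Lemma 2.1]
-/

noncomputable section

namespace Summit.HubbardSuperconductivity.HubbardSuperconductivity.Theorems.PerturbedFermiCurve

set_option linter.dupNamespace false -- summit = problem name (single-conjunct summit), D-0017

open Real Set
open Literature.MathematicalPhysics.QuantumLattice Literature.MathematicalPhysics.QuantumLattice.BandSectorCounting
open Literature.MathematicalPhysics.QuantumLattice.FermiRG Literature.MathematicalPhysics.QuantumLattice.FermiRG.BGM2003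
open Summit.HubbardSuperconductivity.HubbardSuperconductivity.Theorems.ThinLevelSet
open Summit.HubbardSuperconductivity.HubbardSuperconductivity.Theorems.AbsUmklappCount

set_option maxHeartbeats 1600000 in -- the explicit constants are large closed terms (positivity side goals on them)
/-- **The anchored absolute `(L−3)` count of target strings on the perturbed curve, constants uniform over the family.**  See the module docstring.
[cite: BenfattoGiulianiMastropietro2003, §3.1 Lemma 3.1 (4.3) and §7.4] -/
theorem targetStrings_perturbed_uniform {a b : ℝ} (B : BandBounds a b) {κ₀ κ₁ κ₂ e₀ : ℝ} (he₀ : 0 < e₀)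
    (hκ₁0 : 0 ≤ κ₁) (hκ₂0 : 0 ≤ κ₂) (hκ₁D : 2 * κ₁ ≤ B.Dtmin)
    (hconv : B.hmin ≤ 2 * (B.hmin - 4 * (κ₁ * (π * Real.sqrt 2 + 2 * B.smax) / (B.Dtmin - κ₁)) *
        ((B.smax + κ₁ * (π * Real.sqrt 2 + 2 * B.smax) / (B.Dtmin - κ₁)) + B.smax)) -
        κ₂ * (B.smax + κ₁ * (π * Real.sqrt 2 + 2 * B.smax) / (B.Dtmin - κ₁)) ^ 2) :
    ∃ c₂ c₃ K₁ K₂ c₀ c₂' η₀ s₁ Φ cf Af Bf M₁ : ℝ,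
      0 ≤ c₂ ∧ 0 < c₃ ∧ 0 ≤ K₁ ∧ K₂ = K₁ * π + 4 ∧ 2 + c₂ ≤ K₁ ∧ 0 < c₀ ∧ 0 < c₂' ∧ 0 < η₀ ∧
      0 < s₁ ∧ 0 ≤ M₁ ∧ 0 < Φ ∧ 0 < cf ∧ cf ≤ Af ∧ 0 ≤ Bf ∧
      ∀ (δ : (Fin 2 → ℝ) → ℝ), ContDiff ℝ ((⊤ : ℕ∞) : WithTop ℕ∞) δ → (∀ k, δ (-k) = δ k) →
        (∀ k : Fin 2 → ℝ, |δ k| ≤ κ₀) → (∀ k : Fin 2 → ℝ, ‖fderiv ℝ δ k‖ ≤ κ₁) → (∀ k : Fin 2 → ℝ, ‖fderiv ℝ (fderiv ℝ δ) k‖ ≤ κ₂) →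
        ∀ μ : ℝ, a + κ₀ + 2 * e₀ ≤ μ → μ + κ₀ + 2 * e₀ ≤ b →
        ∀ (n' L : ℕ), 6 ≤ L → ∀ (i₁ : Fin L) (ω₁ : ℕ), ω₁ < sectorCount n' → ∀ (R : Fin 2 → ℝ) (Φ₀ LΨ Bfib : ℝ),
          0 ≤ Φ₀ → 2 * Φ₀ ≤ Φ → LΨ = L + c₂ * (π / 2) / (K₁ * Φ₀) → (2 : ℝ) ^ (-(n' : ℤ)) ≤ Φ₀ → c₃ * (2 : ℝ) ^ (-(n' : ℤ)) ≤ Φ₀ →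
          K₂ * LΨ * (c₃ * (2 : ℝ) ^ (-(n' : ℤ))) ≤ c₂' * Φ₀ →
          max ((2 * ((2 * c₀ * K₂ * c₃ / π + 1) * LΨ)) ^ 2) (4 * c₃ ^ 2 * K₂ ^ 2 / η₀ ^ 2 * LΨ ^ 2) ≤ Bfib →
          6 * (M₁ * (2 * Φ₀)) + 3 * (L * (4 * c₃ * (2 : ℝ) ^ (-(n' : ℤ)))) + 2 * (s₁ / 2 * sectorWidth n') ≤ s₁ / 4 * Φ →
          (Nat.card {ω : Fin L → Fin (sectorCount n') |
              (ω i₁ : ℕ) = ω₁ ∧ ∃ k : Fin L → (Fin 2 → ℝ),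
                (∀ i, k i ∈ BGM2003.sSector (fun ϑ e => perturbedFermiRadius δ (μ + e) ϑ) e₀ n' (ω i : ℕ)) ∧ ∑ i, k i = R} : ℝ) ≤
            2 * (L : ℝ) ^ 4 *
              ((2 * (L * (4 * c₃ * (2 : ℝ) ^ (-(n' : ℤ)))) / (s₁ / 2 * sectorWidth n') + 1) *
                (960 * Af * (2 * (L * (4 * c₃ * (2 : ℝ) ^ (-(n' : ℤ))) + Bf * (L * (4 * c₃ * (2 : ℝ) ^ (-(n' : ℤ))))) +
                  (4 * Bf + 1) * (s₁ / 2 * sectorWidth n')) / cf ^ 2 / (s₁ / 2 * sectorWidth n') ^ 2) *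
              ((sectorCount n' : ℝ) * (2 * (2 * Φ₀ / sectorWidth n' + 1)) ^ (L - 5))) +
            (L : ℝ) ^ 2 * 2 ^ L * (L ^ 2 * (Bfib * (3 * (2 : ℝ) ^ n') ^ (L - 3))) := by
  have hDt := B.Dtmin_pos; have hum := B.umin_pos; have hsm := B.smax_pos; have hhm := B.hmin_pos; have hπ := Real.pi_pos
  have hκ₁lt : κ₁ < B.Dtmin := by linarith
  have hden : 0 < B.Dtmin - κ₁ := sub_pos.2 hκ₁lt
  -- (u3): the δ-uniform sector box
  obtain ⟨c₃, hc₃, hbox⟩ := sectorBox_perturbed_uniform B (κ₀ := κ₀) he₀ hκ₁0 hκ₁lt hκ₂0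
  -- the chart package, uniform
  obtain ⟨s₁, Φ, cf, Af, Bf, M₁, hs₁, hM₁, hΦ, hcf, hcfA, hBf, hchartU⟩ := fermiChart_perturbed_uniform B (κ₀ := κ₀) he₀ hκ₁0 hκ₂0 hκ₁D hconv
  -- the shell-uniform radius data and their constants
  set SE : ℝ := B.smax + κ₁ * (π * Real.sqrt 2 + 2 * B.smax) / (B.Dtmin - κ₁) with hSE
  have hSE0 : 0 < SE := by rw [hSE]; positivity
  set M : ℝ := π * Real.sqrt 2 + (4 + κ₁) * (π * Real.sqrt 2) / (B.Dtmin - κ₁) +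
      ((4 + κ₂) * (B.smax + κ₁ * (π * Real.sqrt 2 + 2 * B.smax) / (B.Dtmin - κ₁)) ^ 2 +
        (8 + 2 * κ₁) * ((4 + κ₁) * (π * Real.sqrt 2) / (B.Dtmin - κ₁)) + (4 + κ₁) * (π * Real.sqrt 2)) / (B.Dtmin - κ₁) with hM
  have hM0 : 0 < M := by rw [hM]; positivity
  set cκ : ℝ := B.umin * B.hmin / ((4 + κ₁) * (2 * (B.smax + κ₁ * (π * Real.sqrt 2 + 2 * B.smax) / (B.Dtmin - κ₁))) ^ 3) with hcκ
  have hcκ0 : 0 < cκ := by rw [hcκ]; positivity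
  -- (u2): the Gauss-map Lipschitz constant
  set c₂ : ℝ := 2 + ((4 + κ₂) * (B.smax + κ₁ * (π * Real.sqrt 2 + 2 * B.smax) / (B.Dtmin - κ₁)) ^ 2 +
        (8 + 2 * κ₁) * ((4 + κ₁) * (π * Real.sqrt 2) / (B.Dtmin - κ₁)) + (4 + κ₁) * (π * Real.sqrt 2)) / (B.Dtmin - κ₁) / B.umin with hc₂
  have hc₂0 : 0 ≤ c₂ := by rw [hc₂]; positivity
  -- (u4): the parallelogram constants at `c_r = (2K₁ + 4c₂)/K₂`, `K₁ = 2 + c₂`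
  set K₁ : ℝ := 2 + c₂ with hK₁
  have hK₁0 : 0 ≤ K₁ := by rw [hK₁]; positivity
  set K₂ : ℝ := K₁ * π + 4 with hK₂
  have hK₂0 : 0 < K₂ := by rw [hK₂]; positivity
  set cr : ℝ := (2 * K₁ + 4 * c₂) / K₂ with hcr
  have hcr0 : 0 < cr := by rw [hcr]; positivity
  set Kc : ℝ := B.umin⁻¹ + 4 * M / (B.umin * (B.umin * (2 / π * (cκ * B.umin)))) + (B.umin * (2 / π * (cκ * B.umin)))⁻¹ with hKc
  set c₀ : ℝ := 2 * (1 + cr) * Kc with hc₀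
  have hc₀0 : 0 < c₀ := by rw [hc₀, hKc]; positivity
  set c₂' : ℝ := 1 / (4 * c₀ + 64 * M * (π + 1) * c₀ * Kc + 1) with hc₂'
  have hc₂'0 : 0 < c₂' := by rw [hc₂', hc₀, hKc]; positivity
  refine ⟨c₂, c₃, K₁, K₂, c₀, c₂', 1, s₁, Φ, cf, Af, Bf, M₁, hc₂0, hc₃, hK₁0, rfl, le_rfl, hc₀0, hc₂'0, one_pos,
    hs₁, hM₁, hΦ, hcf, hcfA, hBf, ?_⟩
  intro δ hδs heven hδ hκ hκ₂ μ hlo hhi n' L hL i₁ ω₁ hω₁ R Φ₀ LΨ Bfib hΦ₀ h2Φ₀ hLΨ hΦt hΦδ hΦη hBfib hreg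
  have hδ2 : ContDiff ℝ 2 δ := hδs.of_le (WithTop.coe_le_coe.mpr le_top)
  have hδ' : ∀ k : Fin 2 → ℝ, (∀ i, |k i| ≤ π) → |δ k| ≤ κ₀ := fun k _ => hδ k
  have hκ' : ∀ k : Fin 2 → ℝ, (∀ i, |k i| ≤ π) → ‖fderiv ℝ δ k‖ ≤ κ₁ := fun k _ => hκ k
  have hκ₂' : ∀ k : Fin 2 → ℝ, (∀ i, |k i| ≤ π) → ‖fderiv ℝ (fderiv ℝ δ) k‖ ≤ κ₂ := fun k _ => hκ₂ k
  have hlo0 : a ≤ μ - κ₀ := by linarith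
  have hhi0 : μ + κ₀ ≤ b := by linarith
  have hlo1 : a ≤ μ - κ₀ - e₀ := by linarith
  have hhi1 : μ + κ₀ + e₀ ≤ b := by linarith
  -- §1.2, (u1), (u4)′, (u2), (u3), Lemma 7.5, the chart
  have hD := dispersionHyp_perturbed B hδs heven hδ' hκ' hκ₂' hκ₁D hconv he₀ hlo hhi
  have hrad := chart_radius_ge B hδ2 hδ' hlo1 hhi1
  have hMb := chart_radius_bounds B hδ2 hδ' hlo1 hhi1 hκ' hκ₁lt hκ₂'
  have hcurv := chart_curvature_ge B hδ2 hδ' hlo1 hhi1 hκ' hκ₁lt hκ₂' hconv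
  have hlip := normalAngle_perturbed_lipschitz B hδ2 hδ' hlo0 hhi0 hκ' hκ₁lt hκ₂'
  have hpi := fun θ => normalAngle_perturbed_add_pi heven (μ := μ) θ
  have h73 := hbox δ hδ2 hδ hκ hκ₂ μ hlo1 hhi1
  have h75 := lemma75_parallelogram_of_bounds hD hum hrad hcκ0 hcurv hM0.le hMb hcr0
  have hchart := hchartU δ hδs heven hδ hκ hκ₂ μ hlo hhi
  exact card_targetStrings_le hD hlip hpi hc₂0 hc₃ h73 hK₁0 rfl hc₀0 hc₂'0 one_pos h75 hs₁ hM₁ hΦ hcf hcfA hBf hchart hL i₁ hω₁ R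
    hΦ₀ h2Φ₀ le_rfl hLΨ hΦt hΦδ hΦη hBfib hreg

end Summit.HubbardSuperconductivity.HubbardSuperconductivity.Theorems.PerturbedFermiCurve

end
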